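import Summits.Ventures.HSemireg.WedgeHankelRecurrenceGaussChebyshevLevelSetGeneric
import Mathlib.FieldTheory.KummerExtension

/-!
# Venture HSemireg — **THE LEVEL SETS OF `C_n` OVER A DOMAIN WITH A PRIMITIVE `n`-TH ROOT OF UNITY `ζ`: `C_n(X) − (aⁿ + a⁻ⁿ) = ∏_{i<n} (X − (ζⁱa + ζ⁻ⁱa⁻¹))` for every unit `a`** (the Dickson ∕
# Vieta–Lucas level-set factorisation), in particular **`C_n − 2 = ∏_{i<n} (X − (ζⁱ + ζ⁻ⁱ))`** and, for a primitive `2n`-th root `ξ`, **`C_n + 2 = ∏_{i<n} (X − (ξ^{2i+1} + ξ^{−(2i+1)}))`** — the algebraic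
# form of N502 ∕ N506 (over `ℂ`, `ζⁱ + ζ⁻ⁱ = 2cos(2πi∕n)`)

HONEST FRAMING. Part of the Lean index of the computation cell `pub-hsemireg` (seat p10 gen 49, Sunday typer «UNIFORM-IN-n»).  Commutative algebra only (Mathlib `Polynomial.Chebyshev.C`,
`IsPrimitiveRoot`, `AdjoinRoot`); no variety, no cohomology theory, no sheaf, no Ext group and no semiregularity map is constructed here; nothing here says that HC / HC_CM / HC_AV holds; no
Literature fact (unproved `Prop`) is declared or used.  Custodian versions as in `WedgeHankelSiegelIdeal` (1/3).
SOURCES (cited).  R. Lidl, G. L. Mullen, G. Turnwald, *Dickson Polynomials* (1993), Lemma 2.2 / (1.1) (`D_n(u + a∕u, a) = uⁿ + aⁿ∕uⁿ`) and Thm 3.12 (factorisation of `D_n(x, a) − D_n(c, a)`);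
M. Bhargava, M. E. Zieve, Finite Fields Appl. 5 (1999) 103–111 («Factoring Dickson polynomials over finite fields»); G. Turnwald, Finite Fields Appl. 1 (1995) 64–82.
PROOF TYPED HERE.  In the quadratic extension `B = R[X][t]∕(t² − Xt + 1)` (N489: `τσ = 1`, `τ + σ = X`, `C_n(X) ↦ τⁿ + σⁿ`): for a unit `z`, `X − (z + z⁻¹) = σ (τ − z)(τ − z⁻¹)`; taking the product over
`z = ζⁱa` and using Mathlib `X_pow_sub_C_eq_prod` (Kummer theory: `Yⁿ − c = ∏ (Y − ζⁱα)` when `αⁿ = c`, evaluated at `Y = τ` through `eval₂`) for `ζ` and for `ζ⁻¹` gives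
`σⁿ (τⁿ − aⁿ)(τⁿ − a⁻ⁿ) = τⁿ + σⁿ − (aⁿ + a⁻ⁿ)`; descend along the injection `R[X] → B` (Mathlib `AdjoinRoot.of.injective_of_degree_ne_zero`).
DEDUP DISCLOSURE (`rg -n 'IsPrimitiveRoot|RootsOfUnity' Summits/Ventures/HSemireg/WedgeHankelRecurrence*`, `lean search Chebyshev primitive`, 2026-09-04): N489 ∕ N494 use the same extension
for IDEALS; no element-level factorisation of `C_n − c` over roots of unity is in the tree or in Mathlib (`Polynomial.Chebyshev`, `Dickson`); 0 hits for the 4 names below.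

WHAT IS IN THE TREE.  N489 `quadExt_monic_natDegree`, `quadExt_chebyshevC`; Mathlib `X_pow_sub_C_eq_prod`, `IsPrimitiveRoot.inv ∕ coe_units_iff ∕ pow ∕ eq_neg_one_of_two_right`, `AdjoinRoot`.
THIS FILE (namespace `Summit.Ventures.HSemireg.Wedge.HankelOuter` continued; CHAINED on N506; 0 definitions):
* §1272 `quadExt_X_sub_unit` (`X − (z + z⁻¹) = σ(τ − z)(τ − z⁻¹)`), **`chebyshevC_sub_C_eq_prod_of_isPrimitiveRoot`** (general unit `a`), **`chebyshevC_sub_two_eq_prod_of_isPrimitiveRoot`** (`a = 1`),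
  **`chebyshevC_add_two_eq_prod_of_isPrimitiveRoot`** (`ξ` primitive `2n`-th root, `a = ξ`).
CAVEATS.  `R` an integral domain, `n ≥ 1`; roots of unity and `a` are taken in `Rˣ`.  Nothing Ext-side.  New names only.
-/

open Module Polynomial
open scoped Matrix Polynomial

namespace Summit.Ventures.HSemireg.Wedge.HankelOuter

/-! ## §1272. `C_n − (aⁿ + a⁻ⁿ) = ∏ (X − (ζⁱa + ζ⁻ⁱa⁻¹))` -/

/-- In an `R[X]`-algebra `B` with `τσ = 1`, `τ + σ = X`: **`X − (z + z') = σ (τ − z)(τ − z')` whenever `z z' = 1`.** [Lidl–Mullen–Turnwald (1.1); this file, §1272] -/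
theorem quadExt_X_sub_unit {R B : Type*} [CommRing R] [CommRing B] [Algebra R[X] B] {τ σ : B} (hmul : τ * σ = 1) (hadd : τ + σ = algebraMap R[X] B Polynomial.X)
    {z z' : B} (hz : z * z' = 1) : algebraMap R[X] B Polynomial.X - (z + z') = σ * ((τ - z) * (τ - z')) := by
  rw [← hadd]
  linear_combination (-τ + z + z') * hmul - σ * hz

/-- **THE LEVEL-SET FACTORISATION OF `C_n` OVER ROOTS OF UNITY: `C_n − (aⁿ + a⁻ⁿ) = ∏_{i<n} (X − (ζⁱa + (ζⁱa)⁻¹))`** in `R[X]`, for an integral domain `R`, a primitive `n`-th root of unity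
`ζ ∈ Rˣ` (`n ≥ 1`) and any unit `a ∈ Rˣ`. [Lidl–Mullen–Turnwald Thm 3.12 (`a = 1` Dickson parameter); Bhargava–Zieve 1999; this file, §1272] -/
theorem chebyshevC_sub_C_eq_prod_of_isPrimitiveRoot {R : Type*} [CommRing R] [IsDomain R] {n : ℕ} (hn : 0 < n) {ζ : Rˣ} (hζ : IsPrimitiveRoot ζ n) (a : Rˣ) :
    Polynomial.Chebyshev.C R (n : ℤ) - Polynomial.C (((a ^ n : Rˣ) : R) + ((a ^ n)⁻¹ : Rˣ)) =
      ∏ i ∈ Finset.range n, (Polynomial.X - Polynomial.C (((ζ ^ i * a : Rˣ) : R) + ((ζ ^ i * a)⁻¹ : Rˣ))) := by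
  -- the quadratic extension `B = R[X][t] / (t² − X t + 1)`
  obtain ⟨hf, hf2⟩ := quadExt_monic_natDegree (Polynomial.X : R[X])
  set f : R[X][X] := Polynomial.X ^ 2 - (Polynomial.C (Polynomial.X : R[X]) * Polynomial.X - 1) with hf_def
  have hinj : Function.Injective (algebraMap R[X] (AdjoinRoot f)) := by
    rw [AdjoinRoot.algebraMap_eq]
    exact AdjoinRoot.of.injective_of_degree_ne_zero (by rw [degree_eq_natDegree hf.ne_zero, hf2]; norm_num)
  apply hinj
  have hroot := AdjoinRoot.eval₂_root f
  rw [← AdjoinRoot.algebraMap_eq, hf_def, eval₂_sub, eval₂_sub, eval₂_pow, eval₂_X, eval₂_mul, eval₂_C, eval₂_X, eval₂_one] at hroot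
  set τ : AdjoinRoot f := AdjoinRoot.root f with hτ
  set σ : AdjoinRoot f := algebraMap R[X] (AdjoinRoot f) Polynomial.X - AdjoinRoot.root f with hσ
  have hmul : τ * σ = 1 := by linear_combination (-1 : AdjoinRoot f) * hroot
  have hadd : τ + σ = algebraMap R[X] (AdjoinRoot f) Polynomial.X := by ring
  -- the structure map `φ : R → B`
  set φ : R →+* AdjoinRoot f := (algebraMap R[X] (AdjoinRoot f)).comp Polynomial.C with hφ
  have hφC : ∀ r : R, algebraMap R[X] (AdjoinRoot f) (Polynomial.C r) = φ r := fun r => rfl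
  -- the two Kummer products, evaluated at `τ`
  have hζR : IsPrimitiveRoot (ζ : R) n := IsPrimitiveRoot.coe_units_iff.mpr hζ
  have hζR' : IsPrimitiveRoot ((ζ⁻¹ : Rˣ) : R) n := IsPrimitiveRoot.coe_units_iff.mpr hζ.inv
  have hprod1 : ∏ i ∈ Finset.range n, (τ - φ ((ζ ^ i * a : Rˣ) : R)) = τ ^ n - φ ((a ^ n : Rˣ) : R) := by
    have h := congrArg (Polynomial.eval₂ φ τ) (X_pow_sub_C_eq_prod hζR hn (rfl : ((a : R)) ^ n = (a : R) ^ n))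
    rw [eval₂_sub, eval₂_X_pow, eval₂_C, eval₂_finsetProd] at h
    simp only [eval₂_sub, eval₂_X, eval₂_C] at h
    rw [Units.val_pow_eq_pow_val, h]
    refine Finset.prod_congr rfl fun i _ => ?_
    rw [Units.val_mul, Units.val_pow_eq_pow_val]
  have hprod2 : ∏ i ∈ Finset.range n, (τ - φ (((ζ ^ i * a)⁻¹ : Rˣ) : R)) = τ ^ n - φ (((a ^ n)⁻¹ : Rˣ) : R) := by
    have h := congrArg (Polynomial.eval₂ φ τ) (X_pow_sub_C_eq_prod hζR' hn (rfl : (((a⁻¹ : Rˣ) : R)) ^ n = ((a⁻¹ : Rˣ) : R) ^ n))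
    rw [eval₂_sub, eval₂_X_pow, eval₂_C, eval₂_finsetProd] at h
    simp only [eval₂_sub, eval₂_X, eval₂_C] at h
    rw [← inv_pow, Units.val_pow_eq_pow_val, h]
    refine Finset.prod_congr rfl fun i _ => ?_
    rw [mul_inv, ← inv_pow, Units.val_mul, Units.val_pow_eq_pow_val]
  -- images of both sides
  have hA : φ ((a ^ n : Rˣ) : R) * φ (((a ^ n)⁻¹ : Rˣ) : R) = 1 := by rw [← map_mul, Units.mul_inv, map_one]
  have hmuln : τ ^ n * σ ^ n = 1 := by rw [← mul_pow, hmul, one_pow]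
  have hfac : ∀ i ∈ Finset.range n, algebraMap R[X] (AdjoinRoot f) (Polynomial.X - Polynomial.C (((ζ ^ i * a : Rˣ) : R) + ((ζ ^ i * a)⁻¹ : Rˣ))) =
      σ * ((τ - φ ((ζ ^ i * a : Rˣ) : R)) * (τ - φ (((ζ ^ i * a)⁻¹ : Rˣ) : R))) := fun i _ => by
    simp only [map_sub, map_add, hφC]
    exact quadExt_X_sub_unit hmul hadd (by rw [← map_mul, Units.mul_inv, map_one])
  rw [map_sub, quadExt_chebyshevC hmul hadd n, map_prod, Finset.prod_congr rfl hfac, Finset.prod_mul_distrib, Finset.prod_const, Finset.card_range, Finset.prod_mul_distrib,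
    hprod1, hprod2]
  simp only [map_add, hφC]
  linear_combination (-(τ ^ n) + φ ((a ^ n : Rˣ) : R) + φ (((a ^ n)⁻¹ : Rˣ) : R)) * hmuln - σ ^ n * hA

/-- **`C_n − 2 = ∏_{i<n} (X − (ζⁱ + ζ⁻ⁱ))`** over an integral domain with a primitive `n`-th root of unity `ζ` (`n ≥ 1`). [Lidl–Mullen–Turnwald Thm 3.12; this file, §1272] -/
theorem chebyshevC_sub_two_eq_prod_of_isPrimitiveRoot {R : Type*} [CommRing R] [IsDomain R] {n : ℕ} (hn : 0 < n) {ζ : Rˣ} (hζ : IsPrimitiveRoot ζ n) :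
    Polynomial.Chebyshev.C R (n : ℤ) - 2 = ∏ i ∈ Finset.range n, (Polynomial.X - Polynomial.C (((ζ ^ i : Rˣ) : R) + ((ζ ^ i)⁻¹ : Rˣ))) := by
  have h := chebyshevC_sub_C_eq_prod_of_isPrimitiveRoot hn hζ 1
  simp only [one_pow, inv_one, Units.val_one, mul_one] at h
  rw [← h, ← one_add_one_eq_two, map_add, map_one]

/-- **`C_n + 2 = ∏_{i<n} (X − (ξ^{2i+1} + ξ^{−(2i+1)}))`** over an integral domain with a primitive `2n`-th root of unity `ξ` (`n ≥ 1`; `ξⁿ = −1`). [Lidl–Mullen–Turnwald Thm 3.12; this file, §1272] -/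
theorem chebyshevC_add_two_eq_prod_of_isPrimitiveRoot {R : Type*} [CommRing R] [IsDomain R] {n : ℕ} (hn : 0 < n) {ξ : Rˣ} (hξ : IsPrimitiveRoot ξ (2 * n)) :
    Polynomial.Chebyshev.C R (n : ℤ) + 2 = ∏ i ∈ Finset.range n, (Polynomial.X - Polynomial.C (((ξ ^ (2 * i + 1) : Rˣ) : R) + ((ξ ^ (2 * i + 1))⁻¹ : Rˣ))) := by
  have hζ : IsPrimitiveRoot (ξ ^ 2) n := by
    have h := hξ.pow_of_dvd (p := 2) two_ne_zero (dvd_mul_right 2 n)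
    rwa [Nat.mul_div_cancel_left n two_pos] at h
  have hξn : ξ ^ n = -1 := by
    have h2 : IsPrimitiveRoot (ξ ^ n) 2 := by
      have h := hξ.pow_of_dvd (p := n) hn.ne' (dvd_mul_left n 2)
      rwa [Nat.mul_div_cancel 2 hn] at h
    have h := IsPrimitiveRoot.eq_neg_one_of_two_right (IsPrimitiveRoot.coe_units_iff.mpr h2)
    exact Units.ext (by rw [Units.val_pow_eq_pow_val] at h; rw [Units.val_pow_eq_pow_val, h, Units.val_neg, Units.val_one])
  have h := chebyshevC_sub_C_eq_prod_of_isPrimitiveRoot hn hζ ξ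
  rw [hξn, inv_neg, inv_one, Units.val_neg, Units.val_one, ← sub_eq_add_neg, show ((-1 : R) - 1) = -2 by norm_num, map_neg, sub_neg_eq_add,
    show (Polynomial.C (2 : R)) = 2 from Polynomial.C_ofNat 2] at h
  rw [h]
  refine Finset.prod_congr rfl fun i _ => ?_
  rw [← pow_mul, ← pow_succ]

end Summit.Ventures.HSemireg.Wedge.HankelOuter
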